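import Summits.BirchSwinnertonDyer.BirchSwinnertonDyer.Theorems.RamifiedSevenEllipticUnitsBottomLocalIndexSplitReading
import HarnessLib

set_option linter.dupNamespace false
set_option autoImplicit false

/-!
# Route `RamifiedSevenEllipticUnits` (rung K7r), value crux `EllipticUnitValueSeven`
# (stmt-BirchSwinnertonDyer-19705), line `rubin-formula`, stub S_B4: the carrier input (iii)
# «`E(K) ⊗ ℤ_p ≤ S_p(E/K) ≤ S_{p,rel}(E/K)`» — Kummer families of rational points are compact Selmer
# families, and `ℤ_p`-multiples preserve compatibility (PROVED; `--supports 19705`; closes nothing)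

Cell `bsd-cm`, seat `bsd-cm-k7r-c2` g4. Third file of the seat's reading of the registered stub
`stub_bottomLocalIndexSplitSeven` (memo SB4-RECUT.md, evidence #11 on 19705): the companion file
`…BottomLocalIndexSplitInputs.lean` (p462109) proves S_B4's index identity GIVEN (α) and four inputs
(i)–(iv); this file DISCHARGES input (iii) — `mordellWeilKummerSpan p (κ.layerSubgroup 0) ≤
relaxedCompactSelmerOver (κ.layerSubgroup 0) p {𝔭}` — for every curve over a number field, in the tree's
compact-Selmer currency (Perrin-Riou 1987 §0: "`E(L) ⊗ ℤ_p ↪ S_p(L)`"; Howard 2004 §1: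
"`0 → E(L) ⊗ ℤ_p → S_p(E/L) → lim← Ш_{p^n} → 0`" — the first arrow lands in `S_p`). HONEST FRAMING:
carrier lemmas only; nothing about any curve's arithmetic is asserted; BSD is not proved; no named
fact is minted; every theorem is `sorry`-free.

## What this file proves (all PROVED)

* Part A (any field): `p^k · H¹(H, E[p^k]) = 0` (`pow_nsmul_torsionH1Over_eq_zero`); the components of
  the `ℤ_p`-action `padicPi c` at consecutive levels differ by a multiple of `p^k`
  (`pow_dvd_toZModPow_val_sub`); hence **`ℤ_p`-multiples of `p`-compatible families are `p`-compatible**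
  (`padicPi_mem_compatiblePi`) and `padicPi c` preserves the compact Selmer group
  (`padicPi_mem_compactSelmerOver`).
* Part B (any field, any `K`-algebra field `E`, embedding `ι`): the components of a Kummer family die
  under every local restriction `H¹(H, E[p^k]) → H¹(H_E, E(K̄_E))`
  (`localResTorsionOverOfEmb_eq_zero_of_isKummerFamilyOver`: roots exist globally; Kummer classes
  restrict to Kummer classes, p449855; local Kummer classes die, p461970).
* Part C (number field, bottom layer `K^{ac}_0 = K` of a `ℤ_p`-tower `κ`, where conjugation acts
  trivially): a Kummer family of a `K`-point is a compact Selmer family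
  (`mem_compactSelmerOver_of_isKummerFamilyOver`); **`E(K) ⊗ ℤ_p ≤ S_p(E/K)`**
  (`mordellWeilKummerSpan_le_compactSelmerOver`) and **`≤ S_{p,rel}(E/K)`** for every relaxed set `P`
  (`mordellWeilKummerSpan_le_relaxedCompactSelmerOver`) — input (iii) of
  `LocalIndexSplitReading.hasLocalBottomIndexExp_of_inputs` verbatim (`input_iii`).

References: B. Perrin-Riou, Bull. SMF 115 (1987) §0 pp. 401–402 [PerrinRiou1987BSMF]; B. Howard,
Compositio 140 (2004) §1 [Howard2004HeegnerKolyvagin]; J. H. Silverman, *AEC* VIII.§2 (Kummer sequence)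
[SilvermanAEC2009]; J.-P. Serre, *Local Fields* VII.§5 Prop. 3 [SerreLocalFields1979]; [BKNO]
arXiv:2608.06879v1 §3.1.2 [BurungaleKobayashiNakamuraOta2026] (the relaxed Selmer group).
-/

noncomputable section

open scoped Classical

open WeierstrassCurve NumberField IsDedekindDomain Field
  Literature.NumberTheory.EllipticCurves
  Literature.NumberTheory.GaloisRepresentations
  Literature.NumberTheory.EllipticCurves.BurungaleKobayashiNakamuraOta2026

universe u

namespace Summit.BirchSwinnertonDyer.BirchSwinnertonDyer.Theorems.RamifiedSevenEllipticUnits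

namespace KummerFamiliesSelmer

/-! ## Part A. `p^k` kills `H¹(H, E[p^k])`; `ℤ_p`-multiples of compatible families are compatible -/

section PartA

variable {K : Type u} [Field K] (V : WeierstrassCurve K) (H : Subgroup (Field.absoluteGaloisGroup K))

/-- **`p^k · H¹(H, E[p^k]) = 0`**: every class is the class of a continuous crossed homomorphism with
values in `E[p^k]`, which `p^k` kills pointwise. Serre, *Galois Cohomology*, I.§2.2 (cochains with
values in the coefficient module). [cite: SerreGaloisCohomology1997, I.§2.2] -/
theorem pow_nsmul_torsionH1Over_eq_zero (p : ℕ) (k : ℕ) (x : V.torsionH1Over ((p : ℤ) ^ k) H) :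
    (p ^ k) • x = 0 := by
  obtain ⟨φ, rfl⟩ := oneCocycleClass_surjective (discreteTopRep H (geomTorsion V ((p : ℤ) ^ k))) x
  have hM : ∀ m : geomTorsion V ((p : ℤ) ^ k), (p ^ k) • m = 0 := fun m ↦ by
    apply Subtype.ext
    rw [AddSubmonoidClass.coe_nsmul, ← natCast_zsmul, Nat.cast_pow, ZeroMemClass.coe_zero]
    exact (mem_geomTorsion_iff V _ (m : geomPoints V)).1 m.2
  have hφ : ((p ^ k : ℕ) : ℤ) • φ = 0 := by
    refine Subtype.ext (ContinuousMap.ext fun g ↦ ?_)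
    change ((p ^ k : ℕ) : ℤ) • φ.1 g = 0
    rw [natCast_zsmul]
    exact hM _
  change (p ^ k) • oneCocycleClass _ φ =
    (0 : ↥(continuousCohomology 1 (discreteTopRep H (geomTorsion V ((p : ℤ) ^ k)))))
  rw [← Nat.cast_smul_eq_nsmul ℤ, ← oneCocycleClass_smul, hφ, oneCocycleClass_zero]

/-- The same with an integer multiple: `((p : ℤ)^k · t) · x = 0` on `H¹(H, E[p^k])`.
[cite: SerreGaloisCohomology1997, I.§2.2] -/
theorem zsmul_torsionH1Over_eq_zero_of_dvd (p : ℕ) (k : ℕ) {n : ℤ} (hn : ((p : ℤ) ^ k) ∣ n)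
    (x : V.torsionH1Over ((p : ℤ) ^ k) H) : n • x = 0 := by
  obtain ⟨t, rfl⟩ := hn
  have h1 : ((p : ℤ) ^ k) • x = 0 := by
    have h2 := natCast_zsmul x (p ^ k)
    rw [pow_nsmul_torsionH1Over_eq_zero] at h2
    simpa only [Nat.cast_pow] using h2
  rw [mul_comm, mul_zsmul, h1, zsmul_zero]

variable (p : ℕ) [Fact p.Prime]


/-- Components of the `ℤ_p`-action: `(c · x)_k = (c mod p^k) · x_k` (unfolding `padicPi`).
[cite: PerrinRiou1987BSMF, §0 p. 401 (the `ℤ_p`-module structure of `S_p(L)`)] -/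
theorem padicPi_apply (c : ℤ_[p]) (x : V.torsionH1Pi p H) (k : ℕ) :
    V.padicPi p H c x k = ((PadicInt.toZModPow k c).val : ℤ) • x k := by
  simp only [WeierstrassCurve.padicPi, AddMonoidHom.pi_apply, AddMonoidHom.coe_comp,
    Function.comp_apply, Pi.evalAddMonoidHom_apply, zsmulAddGroupHom_apply]

/-- Consecutive reductions of a `p`-adic integer agree modulo `p^k`:
`p^k ∣ (c mod p^{k+1}) − (c mod p^k)` as integers (`PadicInt.cast_toZModPow`).
[cite: SerreLocalFields1979, II.§1 (ℤ_p = lim ℤ/p^k)] -/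
theorem pow_dvd_toZModPow_val_sub (c : ℤ_[p]) (k : ℕ) :
    ((p : ℤ) ^ k) ∣ ((PadicInt.toZModPow (k + 1) c).val : ℤ) - ((PadicInt.toZModPow k c).val : ℤ) := by
  haveI : NeZero (p ^ k) := ⟨pow_ne_zero _ (Fact.out : p.Prime).ne_zero⟩
  have h : (((PadicInt.toZModPow k c).val : ℤ) : ZMod (p ^ k)) =
      (((PadicInt.toZModPow (k + 1) c).val : ℤ) : ZMod (p ^ k)) := by
    rw [Int.cast_natCast, Int.cast_natCast, ZMod.natCast_zmod_val, ZMod.natCast_val,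
      PadicInt.cast_toZModPow k (k + 1) (Nat.le_succ k) c]
  have := (ZMod.intCast_eq_intCast_iff_dvd_sub _ _ (p ^ k)).1 h
  simpa only [Nat.cast_pow] using this

/-- **`ℤ_p`-multiples of `p`-compatible families are `p`-compatible**: `p_*((c·x)_{k+1}) = (c·x)_k`,
because `p_*` is additive, `c mod p^{k+1} ≡ c mod p^k (mod p^k)` and `p^k` kills level `k`.
(The `ℤ_p`-module structure of `S_p(L) = lim← S(L)^{(p^k)}`.) [cite: PerrinRiou1987BSMF, §0 p. 401] -/
theorem padicPi_mem_compatiblePi (c : ℤ_[p]) {x : V.torsionH1Pi p H}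
    (hx : x ∈ V.compatiblePi H p) : V.padicPi p H c x ∈ V.compatiblePi H p := by
  rw [mem_compatiblePi_iff] at hx ⊢
  intro k
  rw [padicPi_apply, padicPi_apply, map_zsmul, hx k]
  have h := zsmul_torsionH1Over_eq_zero_of_dvd V H p k (pow_dvd_toZModPow_val_sub p c k) (x k)
  calc ((PadicInt.toZModPow (k + 1) c).val : ℤ) • x k
      = (((PadicInt.toZModPow (k + 1) c).val : ℤ) - ((PadicInt.toZModPow k c).val : ℤ)) • x k +
          ((PadicInt.toZModPow k c).val : ℤ) • x k := by rw [← add_zsmul, sub_add_cancel]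
    _ = ((PadicInt.toZModPow k c).val : ℤ) • x k := by rw [h, zero_add]

/-- **`ℤ_p`-multiples preserve the compact Selmer group** `S_p(E/L)` (`L = K̄^H`, `K` a number field):
level-wise Selmer is a subgroup, compatibility by the previous theorem.
[cite: PerrinRiou1987BSMF, §0 p. 401 ("des `ℤ_p`-modules compacts")] -/
theorem padicPi_mem_compactSelmerOver [NumberField K] [H.Normal] (c : ℤ_[p]) {x : V.torsionH1Pi p H}
    (hx : x ∈ V.compactSelmerOver H p) : V.padicPi p H c x ∈ V.compactSelmerOver H p := by
  rw [WeierstrassCurve.mem_compactSelmerOver_iff] at hx ⊢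
  refine ⟨fun k ↦ ?_, mem_compatiblePi_iff.1
    (padicPi_mem_compatiblePi V H p c (mem_compatiblePi_iff.2 hx.2))⟩
  rw [padicPi_apply]
  exact AddSubgroup.zsmul_mem _ (hx.1 k) _

end PartA

/-! ## Part B. Components of a Kummer family die under every local restriction -/

section PartB

variable {K : Type u} [Field K] (V : WeierstrassCurve K) [V.IsElliptic] (p : ℕ) [Fact p.Prime]
  (H : Subgroup (Field.absoluteGaloisGroup K))
  {E : Type u} [Field E] [Algebra K E] (ι : AlgebraicClosure K →ₐ[K] AlgebraicClosure E)

/-- **Kummer families satisfy every local Kummer condition**: if `d` is the Kummer family of the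
`H`-fixed point `P`, then `loc_ι(d_k) = 0` in `H¹(H_E, E(K̄_E))` for every `k` — pick a global `p^k`-th
root `Q` of `P` (`zsmul_geomPoints_surjective_holds`), so `d_k = δ(Q)`; the local restriction factors
through the torsion-coefficient one (`localResTorsionOverOfEmb_eq_comp`), which sends `δ(Q)` to the
local Kummer class of `ι_*Q` (`localTorsionResOfEmb_kummerClassOver`), which dies in `H¹(H_E, E(K̄_E))`
(`LocalIndexSplitReading.torsionToPointsH1_kummerClassOver`). Silverman, *AEC*, VIII.§2 and X.§4.
[cite: SilvermanAEC2009, VIII.§2 (the Kummer sequence) and X.§4 (Remark 4.1.1)] -/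
theorem localResTorsionOverOfEmb_eq_zero_of_isKummerFamilyOver {P : geomPoints V}
    (hP : ∀ σ ∈ H, σ • P = P) {d : V.torsionH1Pi p H} (hd : V.IsKummerFamilyOver p H hP d) (k : ℕ) :
    V.localResTorsionOverOfEmb ((p : ℤ) ^ k) H ι (d k) = 0 := by
  have hpk : ((p : ℤ) ^ k) ≠ 0 := pow_ne_zero _ (Int.natCast_ne_zero.mpr (Fact.out : p.Prime).ne_zero)
  obtain ⟨Q, hQ⟩ := V.zsmul_geomPoints_surjective_holds hpk P
  have hQ' : ((p : ℤ) ^ k) • Q = P := hQ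
  rw [hd k Q hQ', localResTorsionOverOfEmb_eq_comp, AddMonoidHom.coe_comp, Function.comp_apply,
    localTorsionResOfEmb_kummerClassOver]
  exact LocalIndexSplitReading.torsionToPointsH1_kummerClassOver V _ _ _ _

end PartB

/-! ## Part C. Bottom layer of a `ℤ_p`-tower over a number field: Kummer families are compact Selmer
families; `E(K) ⊗ ℤ_p ≤ S_p(E/K) ≤ S_{p,rel}(E/K)` -/

section PartC

variable {K : Type u} [Field K] [NumberField K] (V : WeierstrassCurve K) [V.IsElliptic] (p : ℕ)
  [Fact p.Prime] (κ : ZpExtension K p)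

/-- **A Kummer family of a `K`-point is level-wise Selmer** over the bottom layer `K^{ac}_0 = K`
(`κ.layerSubgroup 0 = Γ_K`, where conjugation acts trivially on `H¹`, Serre *Local Fields* VII.§5
Prop. 3): the local condition at every finite and infinite place is Part B.
[cite: PerrinRiou1987BSMF, §0 p. 401] [cite: SerreLocalFields1979, VII.§5 Prop. 3] -/
theorem mem_selmerTorsionOver_of_isKummerFamilyOver {P : geomPoints V}
    (hP : ∀ σ ∈ κ.layerSubgroup 0, σ • P = P) {d : V.torsionH1Pi p (κ.layerSubgroup 0)}
    (hd : V.IsKummerFamilyOver p (κ.layerSubgroup 0) hP d) (k : ℕ) :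
    d k ∈ V.selmerTorsionOver (κ.layerSubgroup 0) ((p : ℤ) ^ k) := by
  have hconj : ∀ σ : Field.absoluteGaloisGroup K,
      conjH1 (κ.layerSubgroup 0) (geomTorsion V ((p : ℤ) ^ k)) σ (d k) = d k := fun σ ↦ by
    have hσ : σ ∈ κ.layerSubgroup 0 := by
      rw [ZpExtension.layerSubgroup_zero]; trivial
    rw [Literature.NumberTheory.EllipticCurves.conjH1_of_mem_holds (κ.layerSubgroup 0)
      (geomTorsion V ((p : ℤ) ^ k)) hσ, AddMonoidHom.id_apply]
  simp only [WeierstrassCurve.selmerTorsionOver, AddSubgroup.mem_inf, AddSubgroup.mem_iInf,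
    AddSubgroup.mem_comap, AddMonoidHom.mem_ker, hconj]
  exact ⟨fun v _ ↦ localResTorsionOverOfEmb_eq_zero_of_isKummerFamilyOver V p _ _ hP hd k,
    fun w _ ↦ localResTorsionOverOfEmb_eq_zero_of_isKummerFamilyOver V p _ _ hP hd k⟩

/-- **A Kummer family of a `K`-point is a compact Selmer family**: `d ∈ S_p(E/K)` (level-wise Selmer
by the previous theorem, `p`-compatible by `IsKummerFamilyOver.reduceTorsionH1`, p453356) — the first
arrow of Perrin-Riou's / Howard's descent sequence `E(K) ⊗ ℤ_p → S_p(E/K)`.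
[cite: PerrinRiou1987BSMF, §0 pp. 401–402] [cite: Howard2004HeegnerKolyvagin, §1 (descent sequence for S_p(E/L))] -/
theorem mem_compactSelmerOver_of_isKummerFamilyOver {P : geomPoints V}
    (hP : ∀ σ ∈ κ.layerSubgroup 0, σ • P = P) {d : V.torsionH1Pi p (κ.layerSubgroup 0)}
    (hd : V.IsKummerFamilyOver p (κ.layerSubgroup 0) hP d) :
    d ∈ V.compactSelmerOver (κ.layerSubgroup 0) p :=
  (V.mem_compactSelmerOver_iff (κ.layerSubgroup 0) p d).2
    ⟨mem_selmerTorsionOver_of_isKummerFamilyOver V p κ hP hd, hd.reduceTorsionH1 p⟩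

/-- **`E(K) ⊗ ℤ_p ≤ S_p(E/K)`**: the `ℤ_p`-span of the Kummer families of the `K`-points
(`mordellWeilKummerSpan` at the bottom layer) lies in the compact Selmer group (generators by the
previous theorem and `padicPi_mem_compactSelmerOver`; then `AddSubgroup.closure_le`).
[cite: PerrinRiou1987BSMF, §0 pp. 401–402] [cite: Howard2004HeegnerKolyvagin, §1 (descent sequence for S_p(E/L))] -/
theorem mordellWeilKummerSpan_le_compactSelmerOver :
    V.mordellWeilKummerSpan p (κ.layerSubgroup 0) ≤ V.compactSelmerOver (κ.layerSubgroup 0) p := by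
  unfold WeierstrassCurve.mordellWeilKummerSpan WeierstrassCurve.kummerSpan
  rw [AddSubgroup.closure_le]
  rintro x ⟨P, hPS, c, d, hd, rfl⟩
  exact padicPi_mem_compactSelmerOver V _ p c (mem_compactSelmerOver_of_isKummerFamilyOver V p κ _ hd)

/-- **`E(K) ⊗ ℤ_p ≤ S_{p,rel}(E/K)`** for every set `P` of relaxed places (`S_p ≤ S_{p,rel}`,
`compactSelmerOver_le_relaxedCompactSelmerOver`, p441800). [cite: BurungaleKobayashiNakamuraOta2026, §3.1.2 (arXiv:2608.06879 p. 16) (the relaxed Selmer group; shape only)]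
[cite: PerrinRiou1987BSMF, §0 pp. 401–402] -/
theorem mordellWeilKummerSpan_le_relaxedCompactSelmerOver (P : Set (HeightOneSpectrum (𝓞 K))) :
    V.mordellWeilKummerSpan p (κ.layerSubgroup 0) ≤
      V.relaxedCompactSelmerOver (κ.layerSubgroup 0) p P :=
  (mordellWeilKummerSpan_le_compactSelmerOver V p κ).trans
    (V.compactSelmerOver_le_relaxedCompactSelmerOver (κ.layerSubgroup 0) p P)

end PartC

/-! ## Input (iii) of `LocalIndexSplitReading.hasLocalBottomIndexExp_of_inputs`, verbatim -/

section InputIII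

variable (W : WeierstrassCurve ℚ) [W.IsElliptic] (p : ℕ) [Fact p.Prime]
  (K : Type) [Field K] [NumberField K] (𝔭 : HeightOneSpectrum (𝓞 K)) (κ : ZpExtension K p)

/-- **Input (iii) DISCHARGED**: for `E/ℚ` base-changed to the number field `K`, the bottom-layer
Mordell–Weil Kummer span lies in the relaxed-at-`𝔭` compact Selmer group —
`(W.baseChange K).mordellWeilKummerSpan p (κ.layerSubgroup 0) ≤ (W.baseChange K).relaxedCompactSelmerOver (κ.layerSubgroup 0) p {𝔭}`,
the hypothesis `hMG` of `LocalIndexSplitReading.hasLocalBottomIndexExp_of_inputs` /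
`localBottomIndexExp_eq_of_inputs` (p462109). Inputs (i), (ii), (iv) and (α) remain.
[cite: PerrinRiou1987BSMF, §0 pp. 401–402] [cite: BurungaleKobayashiNakamuraOta2026, §3.1.2 (arXiv:2608.06879 p. 16) (shape only)] -/
theorem input_iii :
    (W.baseChange K).mordellWeilKummerSpan p (κ.layerSubgroup 0) ≤
      (W.baseChange K).relaxedCompactSelmerOver (κ.layerSubgroup 0) p {𝔭} :=
  mordellWeilKummerSpan_le_relaxedCompactSelmerOver (W.baseChange K) p κ {𝔭}

end InputIII

end KummerFamiliesSelmer

end Summit.BirchSwinnertonDyer.BirchSwinnertonDyer.Theorems.RamifiedSevenEllipticUnits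

end
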